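import Mathlib
import Summits.Ventures.LatticeQCDFlow.TrivializingMaps.FlowLightCone
import HarnessLib

/-!
# THEOREM L-ω: weighted and exponential light cones for flow-defined field transformations

HONEST FRAMING. This venture is about exact (Metropolis-corrected) sampling algorithms for lattice
gauge theory; figures of merit are autocorrelation/cost numbers at stated couplings and volumes; no
continuum-physics claim. This file is pure finite-dimensional ODE analysis.

WHY. THEOREM L (`FlowLightCone.lean`) treats generators with STRICT read sets (Lüscher's truncated
Wilson-flow generators: footprint `linkBall (2(N+1))`), and gives the factorial profile
`(Kt)^m/m!`. Generators that are only EXPONENTIALLY local (the resummed/strong-coupling maps, any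
generator obtained by inverting a local operator) have no read sets; for them the right statement is a
WEIGHTED Grönwall inequality, which this file proves in the same setting (curves in `W^Λ`, `Λ` finite,
sup norm), together with its exponential-cone corollary for flow maps on `SU(n)^E`.

THEOREM L-ω (`LightCone.weightedLightCone`). Let `x, y : [0,T] → W^Λ` have right derivatives
`x', y'`, let `ω : Λ → (0,∞)` be ANY weight, and suppose the weighted modulus
`ω(i)‖x'_t(i) − y'_t(i)‖ ≤ C · max_j ω(j)‖x_t(j) − y_t(j)‖` on `[0,T)`. Then
`ω(i)‖x_t(i) − y_t(i)‖ ≤ δ e^{Ct}` on `[0,T]` whenever `ω(j)‖x_0(j) − y_0(j)‖ ≤ δ` for all `j`.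
(Proof: Grönwall for `t ↦ (ω(i)(x_t(i) − y_t(i)))_i` in the sup norm.) Sum-form moduli
`‖x'_t(i) − y'_t(i)‖ ≤ ∑_j J(i,j)‖x_t(j) − y_t(j)‖` satisfy the hypothesis with
`C = max_i ∑_j J(i,j) ω(i)/ω(j)` (`weightedLightCone_of_sum`).

FLOW MAPS (`IsFlowMap.weightedLightCone`, `IsFlowMap.expLightCone`). For a flow map `Φ` of a generator
`Z` on `SU(n)^E` (`U̇ = Z_t(U) U`) with link-Lipschitz matrix `‖Z_t(U)_e − Z_t(U')_e‖_F ≤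
∑_{e'} Lip(e,e') ‖U_{e'} − U'_{e'}‖_F`, sup bound `M_Z`, and any potential `ρ : E → ℝ` with
`∑_{e'} Lip(e,e') e^{μ|ρ(e) − ρ(e')|} ≤ K_μ` for all `e` (`μ ≥ 0`): if `V, V'` differ only where
`ρ ≤ 0`, then for `t ∈ [0,T]`

  `‖Φ_t(V)_e − Φ_t(V')_e‖_F ≤ 2n · exp((n K_μ + M_Z) t − μ ρ(e))`

— an exponential light cone with velocity `(n K_μ + M_Z)/μ` in the units of `ρ` (e.g. `ρ` = lattice
distance to the modification set; then `K_μ < ∞` uniformly in the volume is exactly "exponentially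
local generator"). Constants depend on NEITHER `L` NOR `d` when `K_μ, M_Z` do not.

Sources: the exponential form is the classical-lattice analogue of [RazSims2009] H. Raz, R. Sims,
arXiv:0902.0025, Thm. 2 (anharmonic lattice systems, `e^{−μ(d(X,Y) − v|t|)}`); flow equation and
locality heuristics: [Luscher2010Trivializing] M. Lüscher, Commun. Math. Phys. 293 (2010) 899,
arXiv:0907.5491, §3.2, §4.5. Everything here is [ours].
-/

open Set Real

namespace Summit.Ventures.LatticeQCDFlow.TrivializingMaps.LightCone

variable {Λ : Type*} [Fintype Λ] {W : Type*} [NormedAddCommGroup W] [NormedSpace ℝ W]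

/-! ## 1. THEOREM L-ω -/

/-- **THEOREM L-ω (weighted light cone).** Two curves `x, y : [0,T] → W^Λ` with right derivatives
`x', y'`; a positive weight `ω`; the weighted sup-modulus with constant `C ≥ 0`; weighted initial
distance `≤ δ`. Then `ω(i)‖x_t(i) − y_t(i)‖ ≤ δ e^{Ct}` on `[0,T]`. [ours] -/
theorem weightedLightCone {x y x' y' : ℝ → Λ → W} {T C δ : ℝ} (hC : 0 ≤ C) (hδ : 0 ≤ δ)
    (ω : Λ → ℝ) (hω : ∀ i, 0 < ω i)
    (hxc : ContinuousOn x (Icc 0 T)) (hyc : ContinuousOn y (Icc 0 T))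
    (hx : ∀ t ∈ Ico 0 T, HasDerivWithinAt x (x' t) (Ici t) t)
    (hy : ∀ t ∈ Ico 0 T, HasDerivWithinAt y (y' t) (Ici t) t)
    (hmod : ∀ t ∈ Ico 0 T, ∀ (i : Λ) (M : ℝ), 0 ≤ M →
      (∀ j, ω j * ‖x t j - y t j‖ ≤ M) → ω i * ‖x' t i - y' t i‖ ≤ C * M)
    (h0 : ∀ j, ω j * ‖x 0 j - y 0 j‖ ≤ δ) :
    ∀ t ∈ Icc 0 T, ∀ i, ω i * ‖x t i - y t i‖ ≤ δ * exp (C * t) := by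
  -- the weighted difference `v_t = (ω(i) • (x_t(i) - y_t(i)))_i` and its right derivative
  have hnv : ∀ (t : ℝ) (i : Λ), ‖ω i • (x t i - y t i)‖ = ω i * ‖x t i - y t i‖ := fun t i => by
    rw [norm_smul, Real.norm_eq_abs, abs_of_pos (hω i)]
  have hnv' : ∀ (t : ℝ) (i : Λ), ‖ω i • (x' t i - y' t i)‖ = ω i * ‖x' t i - y' t i‖ :=
    fun t i => by rw [norm_smul, Real.norm_eq_abs, abs_of_pos (hω i)]
  have hvc : ContinuousOn (fun t i => ω i • (x t i - y t i)) (Icc 0 T) :=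
    continuousOn_pi.2 fun i =>
      (((continuous_apply i).comp_continuousOn hxc).sub
        ((continuous_apply i).comp_continuousOn hyc)).const_smul (ω i)
  have hvd : ∀ s ∈ Ico 0 T, HasDerivWithinAt (fun t i => ω i • (x t i - y t i))
      (fun i => ω i • (x' s i - y' s i)) (Ici s) s := fun s hs =>
    hasDerivWithinAt_pi.2 fun i =>
      (((hasDerivWithinAt_pi.1 (hx s hs)) i).sub ((hasDerivWithinAt_pi.1 (hy s hs)) i)).const_smul
        (ω i)
  have ha : ‖(fun t i => ω i • (x t i - y t i)) 0‖ ≤ δ :=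
    (pi_norm_le_iff_of_nonneg hδ).2 fun j => by
      show ‖ω j • (x 0 j - y 0 j)‖ ≤ δ
      rw [hnv]; exact h0 j
  have hbound : ∀ s ∈ Ico 0 T, ‖(fun i => ω i • (x' s i - y' s i))‖
      ≤ C * ‖(fun t i => ω i • (x t i - y t i)) s‖ + 0 := by
    intro s hs
    rw [add_zero]
    refine (pi_norm_le_iff_of_nonneg (by positivity)).2 fun i => ?_
    show ‖ω i • (x' s i - y' s i)‖ ≤ C * ‖(fun i => ω i • (x s i - y s i))‖
    rw [hnv']
    exact hmod s hs i _ (norm_nonneg _) fun j => by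
      rw [← hnv]; exact norm_le_pi_norm (fun i => ω i • (x s i - y s i)) j
  intro t ht i
  have hG := norm_le_gronwallBound_of_norm_deriv_right_le hvc hvd ha hbound t ht
  rw [gronwallBound_ε0, sub_zero] at hG
  rw [← hnv]
  exact (norm_le_pi_norm (fun i => ω i • (x t i - y t i)) i).trans hG

/-- THEOREM L-ω for globally defined curves (`HasDerivAt` everywhere). [ours] -/
theorem weightedLightCone_of_hasDerivAt {x y x' y' : ℝ → Λ → W} {T C δ : ℝ} (hC : 0 ≤ C)
    (hδ : 0 ≤ δ) (ω : Λ → ℝ) (hω : ∀ i, 0 < ω i)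
    (hx : ∀ t, HasDerivAt x (x' t) t) (hy : ∀ t, HasDerivAt y (y' t) t)
    (hmod : ∀ t ∈ Ico 0 T, ∀ (i : Λ) (M : ℝ), 0 ≤ M →
      (∀ j, ω j * ‖x t j - y t j‖ ≤ M) → ω i * ‖x' t i - y' t i‖ ≤ C * M)
    (h0 : ∀ j, ω j * ‖x 0 j - y 0 j‖ ≤ δ) :
    ∀ t ∈ Icc 0 T, ∀ i, ω i * ‖x t i - y t i‖ ≤ δ * exp (C * t) :=
  weightedLightCone hC hδ ω hω (fun t _ => (hx t).continuousAt.continuousWithinAt)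
    (fun t _ => (hy t).continuousAt.continuousWithinAt) (fun t _ => (hx t).hasDerivWithinAt)
    (fun t _ => (hy t).hasDerivWithinAt) hmod h0

/-- **Sum-form moduli.** If `‖x'_t(i) − y'_t(i)‖ ≤ ∑_j J(i,j)‖x_t(j) − y_t(j)‖` with `J ≥ 0` and the
weight satisfies `∑_j J(i,j) ω(i)/ω(j) ≤ C` for every `i`, then the weighted light cone holds with
rate `C`. (For `ω = e^{μρ}` this is the usual "exponentially local interaction" condition.) [ours] -/
theorem weightedLightCone_of_sum {x y x' y' : ℝ → Λ → W} {T C δ : ℝ} (hδ : 0 ≤ δ)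
    (J : Λ → Λ → ℝ) (hJ : ∀ i j, 0 ≤ J i j) (ω : Λ → ℝ) (hω : ∀ i, 0 < ω i)
    (hC : ∀ i, ∑ j, J i j * (ω i / ω j) ≤ C)
    (hxc : ContinuousOn x (Icc 0 T)) (hyc : ContinuousOn y (Icc 0 T))
    (hx : ∀ t ∈ Ico 0 T, HasDerivWithinAt x (x' t) (Ici t) t)
    (hy : ∀ t ∈ Ico 0 T, HasDerivWithinAt y (y' t) (Ici t) t)
    (hlip : ∀ t ∈ Ico 0 T, ∀ i, ‖x' t i - y' t i‖ ≤ ∑ j, J i j * ‖x t j - y t j‖)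
    (h0 : ∀ j, ω j * ‖x 0 j - y 0 j‖ ≤ δ) :
    ∀ t ∈ Icc 0 T, ∀ i, ω i * ‖x t i - y t i‖ ≤ δ * exp (C * t) := by
  intro t ht i
  have hC0 : 0 ≤ C :=
    (Finset.sum_nonneg fun j _ => mul_nonneg (hJ i j) (div_pos (hω i) (hω j)).le).trans (hC i)
  refine weightedLightCone hC0 hδ ω hω hxc hyc hx hy (fun s hs i M hM hN => ?_) h0 t ht i
  calc ω i * ‖x' s i - y' s i‖
      ≤ ω i * ∑ j, J i j * ‖x s j - y s j‖ := mul_le_mul_of_nonneg_left (hlip s hs i) (hω i).le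
    _ = ∑ j, J i j * (ω i / ω j) * (ω j * ‖x s j - y s j‖) := by
        rw [Finset.mul_sum]
        refine Finset.sum_congr rfl fun j _ => ?_
        have hj : ω j ≠ 0 := (hω j).ne'
        field_simp
    _ ≤ ∑ j, J i j * (ω i / ω j) * M :=
        Finset.sum_le_sum fun j _ =>
          mul_le_mul_of_nonneg_left (hN j) (mul_nonneg (hJ i j) (div_pos (hω i) (hω j)).le)
    _ = (∑ j, J i j * (ω i / ω j)) * M := by rw [Finset.sum_mul]
    _ ≤ C * M := mul_le_mul_of_nonneg_right (hC i) hM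

end Summit.Ventures.LatticeQCDFlow.TrivializingMaps.LightCone

/-! ## 2. Lüscher flow lines and flow maps -/

namespace Summit.Ventures.LatticeQCDFlow.TrivializingMaps

open Literature.MathematicalPhysics.QuantumFieldTheory
open Literature.MathematicalPhysics.QuantumFieldTheory.Luscher2010
open Literature.MathematicalPhysics.QuantumFieldTheory.WilsonFlow (coeConfig)
open scoped Matrix Matrix.Norms.Frobenius

variable {d L n : ℕ} [NeZero L]

/-- **THEOREM L-ω for Lüscher flow lines** (`U̇_t = Z_t(U_t) U_t`, `V̇_t = Z'_t(V_t) V_t`): a weighted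
modulus for the velocity difference gives `ω(e)‖U_t(e) − V_t(e)‖_F ≤ δ e^{Ct}` on `[0,T]`. [ours] -/
theorem IsFlowLine.weightedLightCone {Z Z' : Generator d L n} {U V : ℝ → AmbConfig d L n}
    (hU : IsFlowLine Z U) (hV : IsFlowLine Z' V) {T C δ : ℝ} (hC : 0 ≤ C) (hδ : 0 ≤ δ)
    (ω : Edge d L → ℝ) (hω : ∀ e, 0 < ω e)
    (hmod : ∀ t ∈ Set.Ico 0 T, ∀ (e : Edge d L) (M : ℝ), 0 ≤ M →
      (∀ e', ω e' * ‖U t e' - V t e'‖ ≤ M) →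
      ω e * ‖Z t (U t) e * U t e - Z' t (V t) e * V t e‖ ≤ C * M)
    (h0 : ∀ e, ω e * ‖U 0 e - V 0 e‖ ≤ δ) :
    ∀ t ∈ Set.Icc 0 T, ∀ e, ω e * ‖U t e - V t e‖ ≤ δ * Real.exp (C * t) :=
  LightCone.weightedLightCone_of_hasDerivAt (x' := fun t e => Z t (U t) e * U t e)
    (y' := fun t e => Z' t (V t) e * V t e) hC hδ ω hω
    (fun t => hasDerivAt_pi.2 fun e => WilsonFlow.hasDerivAt_of_entries fun i j => hU t e i j)
    (fun t => hasDerivAt_pi.2 fun e => WilsonFlow.hasDerivAt_of_entries fun i j => hV t e i j)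
    hmod h0

/-- **WEIGHTED LIGHT CONE FOR THE FLOW-DEFINED MAP.** `Φ` a flow map of `Z` on `SU(n)^E`; on the
window `[0,T)` the generator has the WEIGHTED link-Lipschitz modulus `K_Z` (w.r.t. the weight `ω`)
and the sup bound `M_Z`. Then `ω(e)‖Φ_t(V)_e − Φ_t(V')_e‖_F ≤ δ e^{(nK_Z + M_Z)t}` whenever the
weighted initial distance is `≤ δ`. [ours] -/
theorem IsFlowMap.weightedLightCone {Z : Generator d L n}
    {Φ : ℝ → GaugeConfig d L (Matrix.specialUnitaryGroup (Fin n) ℂ) →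
      GaugeConfig d L (Matrix.specialUnitaryGroup (Fin n) ℂ)}
    (hΦ : IsFlowMap Z Φ) (ω : Edge d L → ℝ) (hω : ∀ e, 0 < ω e) {KZ MZ : ℝ} (hKZ : 0 ≤ KZ)
    (hMZ : 0 ≤ MZ) (T : ℝ)
    (hZlip : ∀ t ∈ Set.Ico 0 T, ∀ (U U' : GaugeConfig d L (Matrix.specialUnitaryGroup (Fin n) ℂ))
      (e : Edge d L) (M : ℝ), 0 ≤ M → (∀ e', ω e' * ‖coeConfig U e' - coeConfig U' e'‖ ≤ M) →
      ω e * ‖Z t (coeConfig U) e - Z t (coeConfig U') e‖ ≤ KZ * M)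
    (hZbd : ∀ t ∈ Set.Ico 0 T, ∀ (U : GaugeConfig d L (Matrix.specialUnitaryGroup (Fin n) ℂ))
      (e : Edge d L), ‖Z t (coeConfig U) e‖ ≤ MZ)
    (V V' : GaugeConfig d L (Matrix.specialUnitaryGroup (Fin n) ℂ)) {δ : ℝ} (hδ : 0 ≤ δ)
    (hVV' : ∀ e, ω e * ‖coeConfig V e - coeConfig V' e‖ ≤ δ) :
    ∀ t ∈ Set.Icc 0 T, ∀ e, ω e * ‖coeConfig (Φ t V) e - coeConfig (Φ t V') e‖ ≤
      δ * Real.exp ((n * KZ + MZ) * t) := by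
  have hK : 0 ≤ (n : ℝ) * KZ + MZ := by positivity
  have hle : ∀ (U : GaugeConfig d L (Matrix.specialUnitaryGroup (Fin n) ℂ)) (e : Edge d L),
      ‖coeConfig U e‖ ≤ n := fun U e => by
    rw [WilsonFlow.coeConfig_apply]; exact frobenius_norm_coe_SU_le (U e)
  refine IsFlowLine.weightedLightCone (hΦ.2 V) (hΦ.2 V') hK hδ ω hω ?_ ?_
  · intro t ht e M hM hNe
    have h1 : ω e * ‖Z t (coeConfig (Φ t V)) e - Z t (coeConfig (Φ t V')) e‖ ≤ KZ * M :=
      hZlip t ht (Φ t V) (Φ t V') e M hM hNe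
    have h2 : ‖Z t (coeConfig (Φ t V')) e‖ ≤ MZ := hZbd t ht (Φ t V') e
    have h3 : ‖coeConfig (Φ t V) e‖ ≤ n := hle (Φ t V) e
    have h4 : ω e * ‖coeConfig (Φ t V) e - coeConfig (Φ t V') e‖ ≤ M := hNe e
    have h5 : 0 ≤ ω e * ‖coeConfig (Φ t V) e - coeConfig (Φ t V') e‖ :=
      mul_nonneg (hω e).le (norm_nonneg _)
    have hsplit : Z t (coeConfig (Φ t V)) e * coeConfig (Φ t V) e
        - Z t (coeConfig (Φ t V')) e * coeConfig (Φ t V') e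
        = (Z t (coeConfig (Φ t V)) e - Z t (coeConfig (Φ t V')) e) * coeConfig (Φ t V) e
          + Z t (coeConfig (Φ t V')) e * (coeConfig (Φ t V) e - coeConfig (Φ t V') e) := by
      rw [sub_mul, mul_sub]; abel
    rw [hsplit]
    calc ω e * ‖(Z t (coeConfig (Φ t V)) e - Z t (coeConfig (Φ t V')) e) * coeConfig (Φ t V) e
          + Z t (coeConfig (Φ t V')) e * (coeConfig (Φ t V) e - coeConfig (Φ t V') e)‖
        ≤ ω e * (‖Z t (coeConfig (Φ t V)) e - Z t (coeConfig (Φ t V')) e‖ * ‖coeConfig (Φ t V) e‖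
          + ‖Z t (coeConfig (Φ t V')) e‖ * ‖coeConfig (Φ t V) e - coeConfig (Φ t V') e‖) :=
          mul_le_mul_of_nonneg_left
            ((norm_add_le _ _).trans (add_le_add (norm_mul_le _ _) (norm_mul_le _ _))) (hω e).le
      _ = ω e * ‖Z t (coeConfig (Φ t V)) e - Z t (coeConfig (Φ t V')) e‖ * ‖coeConfig (Φ t V) e‖
          + ‖Z t (coeConfig (Φ t V')) e‖
            * (ω e * ‖coeConfig (Φ t V) e - coeConfig (Φ t V') e‖) := by ring
      _ ≤ KZ * M * n + MZ * M := by
          gcongr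
      _ = (n * KZ + MZ) * M := by ring
  · intro e
    rw [hΦ.1 V, hΦ.1 V']
    exact hVV' e

/-- **EXPONENTIAL LIGHT CONE FOR FLOW MAPS OF EXPONENTIALLY LOCAL GENERATORS.** `Z` has the
link-Lipschitz matrix `Lip ≥ 0` (`‖Z_t(U)_e − Z_t(U')_e‖_F ≤ ∑_{e'} Lip(e,e')‖U_{e'} − U'_{e'}‖_F`)
and sup bound `M_Z` on `[0,T)`; `ρ` is any potential with `∑_{e'} Lip(e,e') e^{μ|ρ(e) − ρ(e')|} ≤ K_μ`
for every `e` (`μ ≥ 0`). If `V, V'` agree wherever `ρ > 0`, then on `[0,T]`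
`‖Φ_t(V)_e − Φ_t(V')_e‖_F ≤ 2n · exp((nK_μ + M_Z)t − μρ(e))`. [ours; cf. RazSims2009 Thm. 2] -/
theorem IsFlowMap.expLightCone {Z : Generator d L n}
    {Φ : ℝ → GaugeConfig d L (Matrix.specialUnitaryGroup (Fin n) ℂ) →
      GaugeConfig d L (Matrix.specialUnitaryGroup (Fin n) ℂ)}
    (hΦ : IsFlowMap Z Φ) (Lip : Edge d L → Edge d L → ℝ) (hLip : ∀ e e', 0 ≤ Lip e e') (T : ℝ)
    (hZlip : ∀ t ∈ Set.Ico 0 T, ∀ (U U' : GaugeConfig d L (Matrix.specialUnitaryGroup (Fin n) ℂ))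
      (e : Edge d L), ‖Z t (coeConfig U) e - Z t (coeConfig U') e‖
        ≤ ∑ e', Lip e e' * ‖coeConfig U e' - coeConfig U' e'‖)
    {MZ : ℝ} (hMZ : 0 ≤ MZ)
    (hZbd : ∀ t ∈ Set.Ico 0 T, ∀ (U : GaugeConfig d L (Matrix.specialUnitaryGroup (Fin n) ℂ))
      (e : Edge d L), ‖Z t (coeConfig U) e‖ ≤ MZ)
    (ρ : Edge d L → ℝ) {μ Kμ : ℝ} (hμ : 0 ≤ μ)
    (hK : ∀ e, ∑ e', Lip e e' * Real.exp (μ * |ρ e - ρ e'|) ≤ Kμ)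
    (V V' : GaugeConfig d L (Matrix.specialUnitaryGroup (Fin n) ℂ))
    (hVV' : ∀ e, V e ≠ V' e → ρ e ≤ 0) :
    ∀ t ∈ Set.Icc 0 T, ∀ e, ‖coeConfig (Φ t V) e - coeConfig (Φ t V') e‖ ≤
      2 * n * Real.exp ((n * Kμ + MZ) * t - μ * ρ e) := by
  intro t ht e
  have hKμ : 0 ≤ Kμ :=
    (Finset.sum_nonneg fun e' _ => mul_nonneg (hLip e e') (Real.exp_pos _).le).trans (hK e)
  have hω : ∀ e : Edge d L, 0 < Real.exp (μ * ρ e) := fun e => Real.exp_pos _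
  have hle : ∀ (U : GaugeConfig d L (Matrix.specialUnitaryGroup (Fin n) ℂ)) (e : Edge d L),
      ‖coeConfig U e‖ ≤ n := fun U e => by
    rw [WilsonFlow.coeConfig_apply]; exact frobenius_norm_coe_SU_le (U e)
  have hδ : (0 : ℝ) ≤ 2 * n := by positivity
  -- weighted Lipschitz modulus of `Z` for `ω = e^{μρ}`
  have hZlipω : ∀ s ∈ Set.Ico 0 T,
      ∀ (U U' : GaugeConfig d L (Matrix.specialUnitaryGroup (Fin n) ℂ)) (e : Edge d L) (M : ℝ),
      0 ≤ M → (∀ e', Real.exp (μ * ρ e') * ‖coeConfig U e' - coeConfig U' e'‖ ≤ M) →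
      Real.exp (μ * ρ e) * ‖Z s (coeConfig U) e - Z s (coeConfig U') e‖ ≤ Kμ * M := by
    intro s hs U U' e M hM hN
    have hratio : ∀ e', Real.exp (μ * ρ e) / Real.exp (μ * ρ e') ≤ Real.exp (μ * |ρ e - ρ e'|) :=
      fun e' => by
        rw [← Real.exp_sub, Real.exp_le_exp, ← mul_sub]
        exact mul_le_mul_of_nonneg_left (le_abs_self _) hμ
    calc Real.exp (μ * ρ e) * ‖Z s (coeConfig U) e - Z s (coeConfig U') e‖
        ≤ Real.exp (μ * ρ e) * ∑ e', Lip e e' * ‖coeConfig U e' - coeConfig U' e'‖ :=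
          mul_le_mul_of_nonneg_left (hZlip s hs U U' e) (hω e).le
      _ = ∑ e', Lip e e' * (Real.exp (μ * ρ e) / Real.exp (μ * ρ e'))
            * (Real.exp (μ * ρ e') * ‖coeConfig U e' - coeConfig U' e'‖) := by
          rw [Finset.mul_sum]
          refine Finset.sum_congr rfl fun e' _ => ?_
          have he' : Real.exp (μ * ρ e') ≠ 0 := (hω e').ne'
          field_simp
      _ ≤ ∑ e', Lip e e' * Real.exp (μ * |ρ e - ρ e'|) * M :=
          Finset.sum_le_sum fun e' _ =>
            mul_le_mul (mul_le_mul_of_nonneg_left (hratio e') (hLip e e')) (hN e')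
              (mul_nonneg (hω e').le (norm_nonneg _))
              (mul_nonneg (hLip e e') (Real.exp_pos _).le)
      _ = (∑ e', Lip e e' * Real.exp (μ * |ρ e - ρ e'|)) * M := by rw [Finset.sum_mul]
      _ ≤ Kμ * M := mul_le_mul_of_nonneg_right (hK e) hM
  -- weighted initial distance `≤ 2n`
  have h0 : ∀ e', Real.exp (μ * ρ e') * ‖coeConfig V e' - coeConfig V' e'‖ ≤ 2 * n := by
    intro e'
    by_cases hVe : V e' = V' e'
    · rw [WilsonFlow.coeConfig_apply, WilsonFlow.coeConfig_apply, hVe, sub_self, norm_zero,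
        mul_zero]
      exact hδ
    · have hρ : Real.exp (μ * ρ e') ≤ 1 :=
        Real.exp_le_one_iff.2 (mul_nonpos_of_nonneg_of_nonpos hμ (hVV' e' hVe))
      have hdist : ‖coeConfig V e' - coeConfig V' e'‖ ≤ 2 * n :=
        calc ‖coeConfig V e' - coeConfig V' e'‖ ≤ ‖coeConfig V e'‖ + ‖coeConfig V' e'‖ :=
              norm_sub_le _ _
          _ ≤ n + n := add_le_add (hle V e') (hle V' e')
          _ = 2 * n := by ring
      calc Real.exp (μ * ρ e') * ‖coeConfig V e' - coeConfig V' e'‖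
          ≤ 1 * (2 * n) := mul_le_mul hρ hdist (norm_nonneg _) zero_le_one
        _ = 2 * n := one_mul _
  have hmain := IsFlowMap.weightedLightCone hΦ (fun e => Real.exp (μ * ρ e)) hω hKμ hMZ T hZlipω
    hZbd V V' hδ h0 t ht e
  -- unweight
  have hexp : Real.exp ((n * Kμ + MZ) * t - μ * ρ e)
      = Real.exp ((n * Kμ + MZ) * t) / Real.exp (μ * ρ e) := Real.exp_sub _ _
  rw [hexp, mul_div_assoc', le_div_iff₀ (hω e), mul_comm]
  exact hmain

end Summit.Ventures.LatticeQCDFlow.TrivializingMaps
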